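import Mathlib

/-!
# Commutant of a non-scalar 2 × 2 matrix (C-COMMON-COMMUTANT2)

Shared Common support module (t4-typer-2 g6, plan-4 g8's by-name ask S16725): over a field `F`,
the commutant of a non-scalar `2 × 2` matrix `A` is the two-dimensional algebra `F[A] = F·1 + F·A`,
and a matrix commuting with two "separated" non-scalar matrices is scalar.

* `commute_two_by_two_of_not_scalar` — `Commute A B` with `A` non-scalar gives `B = x • 1 + y • A`.
  Proof by the four entry equations of `A * B = B * A`: writing `A = [[a, b], [c, d]]`, non-scalar
  means one of `b ≠ 0`, `c ≠ 0`, `a ≠ d`, and each case yields `x, y` explicitly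
  (`y = q / b`, `y = r / c`, `y = (p - s) / (a - d)` respectively, `x = p - y * a`).
* `eq_scalar_of_commute_two_of_not_scalar` — the engine of «two distinct tori meet in the centre»:
  if `B` commutes with non-scalar `A` and `A'`, and `A' ∉ F·1 + F·A`, then `B` is scalar.

Mathlib only. No definition, no instance, no printed input.
-/

namespace Summit.Ventures.HodgeRepro.Tier4.Common

open Matrix

variable {F : Type*} [Field F]

/-- A `2 × 2` matrix whose off-diagonal entries vanish and whose diagonal entries agree is scalar. -/
theorem eq_smul_one_of_entries (A : Matrix (Fin 2) (Fin 2) F) (hb : A 0 1 = 0) (hc : A 1 0 = 0)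
    (had : A 0 0 = A 1 1) : A = A 0 0 • (1 : Matrix (Fin 2) (Fin 2) F) := by
  ext i j
  fin_cases i <;> fin_cases j <;> simp [Matrix.smul_apply, hb, hc, had]

/-- The four entry equations of `A * B = B * A` for `2 × 2` matrices. -/
theorem entries_of_commute (A B : Matrix (Fin 2) (Fin 2) F) (hAB : Commute A B) :
    A 0 0 * B 0 0 + A 0 1 * B 1 0 = B 0 0 * A 0 0 + B 0 1 * A 1 0 ∧
    A 0 0 * B 0 1 + A 0 1 * B 1 1 = B 0 0 * A 0 1 + B 0 1 * A 1 1 ∧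
    A 1 0 * B 0 0 + A 1 1 * B 1 0 = B 1 0 * A 0 0 + B 1 1 * A 1 0 ∧
    A 1 0 * B 0 1 + A 1 1 * B 1 1 = B 1 0 * A 0 1 + B 1 1 * A 1 1 := by
  have h : A * B = B * A := hAB
  refine ⟨?_, ?_, ?_, ?_⟩
  · have := congrFun (congrFun h 0) 0
    simpa [Matrix.mul_apply, Fin.sum_univ_two] using this
  · have := congrFun (congrFun h 0) 1
    simpa [Matrix.mul_apply, Fin.sum_univ_two] using this
  · have := congrFun (congrFun h 1) 0
    simpa [Matrix.mul_apply, Fin.sum_univ_two] using this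
  · have := congrFun (congrFun h 1) 1
    simpa [Matrix.mul_apply, Fin.sum_univ_two] using this

/-- Entrywise criterion for `B = x • 1 + y • A` in `2 × 2`. -/
theorem eq_smul_one_add_smul_of_entries (A B : Matrix (Fin 2) (Fin 2) F) (x y : F)
    (h00 : B 0 0 = x + y * A 0 0) (h01 : B 0 1 = y * A 0 1) (h10 : B 1 0 = y * A 1 0)
    (h11 : B 1 1 = x + y * A 1 1) :
    B = x • (1 : Matrix (Fin 2) (Fin 2) F) + y • A := by
  ext i j
  fin_cases i <;> fin_cases j <;>
    simp [Matrix.add_apply, Matrix.smul_apply, h00, h01, h10, h11]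

/-- **The commutant of a non-scalar `2 × 2` matrix over a field is `F·1 + F·A`** (plan-4 g8 S16725 (1)):
if `A` is not a scalar matrix and `B` commutes with `A`, then `B = x • 1 + y • A` for some `x y : F`. -/
theorem commute_two_by_two_of_not_scalar (A B : Matrix (Fin 2) (Fin 2) F)
    (hA : ∀ c : F, A ≠ c • (1 : Matrix (Fin 2) (Fin 2) F)) (hAB : Commute A B) :
    ∃ x y : F, B = x • (1 : Matrix (Fin 2) (Fin 2) F) + y • A := by
  obtain ⟨e00, e01, e10, e11⟩ := entries_of_commute A B hAB
  by_cases hb : A 0 1 = 0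
  · by_cases hc : A 1 0 = 0
    · -- diagonal `A`: non-scalar forces `a ≠ d`; then `B` is diagonal as well.
      have had : A 0 0 ≠ A 1 1 := fun h => hA (A 0 0) (eq_smul_one_of_entries A hb hc h)
      have hq : B 0 1 = 0 := by
        have h1 : B 0 1 * (A 0 0 - A 1 1) = 0 := by
          rw [hb] at e01; linear_combination e01
        rcases mul_eq_zero.1 h1 with h | h
        · exact h
        · exact absurd (sub_eq_zero.1 h) had
      have hr : B 1 0 = 0 := by
        have h1 : B 1 0 * (A 1 1 - A 0 0) = 0 := by
          rw [hc] at e10; linear_combination e10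
        rcases mul_eq_zero.1 h1 with h | h
        · exact h
        · exact absurd (sub_eq_zero.1 h).symm had
      have hsub : A 0 0 - A 1 1 ≠ 0 := sub_ne_zero.2 had
      refine ⟨B 0 0 - (B 0 0 - B 1 1) / (A 0 0 - A 1 1) * A 0 0,
        (B 0 0 - B 1 1) / (A 0 0 - A 1 1), eq_smul_one_add_smul_of_entries A B _ _ ?_ ?_ ?_ ?_⟩
      · ring
      · rw [hq, hb, mul_zero]
      · rw [hr, hc, mul_zero]
      · field_simp
        ring
    · -- `c ≠ 0`: `y = r / c`, `x = p - y * a`.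
      refine ⟨B 0 0 - B 1 0 / A 1 0 * A 0 0, B 1 0 / A 1 0,
        eq_smul_one_add_smul_of_entries A B _ _ ?_ ?_ ?_ ?_⟩
      · ring
      · rw [hb, mul_zero]
        -- from `e00`: `b r = q c` with `b = 0` gives `q c = 0`, so `q = 0`.
        have h1 : B 0 1 * A 1 0 = 0 := by rw [hb] at e00; linear_combination -e00
        rcases mul_eq_zero.1 h1 with h | h
        · exact h
        · exact absurd h hc
      · field_simp
      · field_simp
        linear_combination -e10
  · -- `b ≠ 0`: `y = q / b`, `x = p - y * a`.
    refine ⟨B 0 0 - B 0 1 / A 0 1 * A 0 0, B 0 1 / A 0 1,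
      eq_smul_one_add_smul_of_entries A B _ _ ?_ ?_ ?_ ?_⟩
    · ring
    · field_simp
    · field_simp
      linear_combination e00
    · field_simp
      linear_combination e01

/-- **A matrix commuting with two separated non-scalar `2 × 2` matrices is scalar** (plan-4 g8
S16725 (2)): if `B` commutes with `A` and `A'`, both non-scalar, and `A'` is not of the form
`x • 1 + y • A`, then `B = c • 1`. -/
theorem eq_scalar_of_commute_two_of_not_scalar (A A' B : Matrix (Fin 2) (Fin 2) F)
    (hA : ∀ c : F, A ≠ c • (1 : Matrix (Fin 2) (Fin 2) F))
    (hA' : ∀ c : F, A' ≠ c • (1 : Matrix (Fin 2) (Fin 2) F))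
    (hsep : ∀ x y : F, A' ≠ x • (1 : Matrix (Fin 2) (Fin 2) F) + y • A)
    (hB : Commute A B) (hB' : Commute A' B) :
    ∃ c : F, B = c • (1 : Matrix (Fin 2) (Fin 2) F) := by
  obtain ⟨x, y, hxy⟩ := commute_two_by_two_of_not_scalar A B hA hB
  obtain ⟨x', y', hxy'⟩ := commute_two_by_two_of_not_scalar A' B hA' hB'
  by_cases hy' : y' = 0
  · exact ⟨x', by rw [hxy', hy', zero_smul, add_zero]⟩
  · exfalso
    apply hsep (y'⁻¹ * (x - x')) (y'⁻¹ * y)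
    have h2 : x' • (1 : Matrix (Fin 2) (Fin 2) F) + y' • A' = x • 1 + y • A := by
      rw [← hxy', ← hxy]
    have h1 : y' • A' = (x - x') • (1 : Matrix (Fin 2) (Fin 2) F) + y • A := by
      calc y' • A' = (x' • (1 : Matrix (Fin 2) (Fin 2) F) + y' • A') - x' • 1 := by abel
        _ = (x • (1 : Matrix (Fin 2) (Fin 2) F) + y • A) - x' • 1 := by rw [h2]
        _ = (x - x') • (1 : Matrix (Fin 2) (Fin 2) F) + y • A := by rw [sub_smul]; abel
    calc A' = y'⁻¹ • (y' • A') := by rw [smul_smul, inv_mul_cancel₀ hy', one_smul]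
      _ = (y'⁻¹ * (x - x')) • (1 : Matrix (Fin 2) (Fin 2) F) + (y'⁻¹ * y) • A := by
        rw [h1, smul_add, smul_smul, smul_smul]

end Summit.Ventures.HodgeRepro.Tier4.Common
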